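import Summits.Ventures.PercRepro.CoreCount
import Summits.Ventures.PercRepro.RankLevelSetCoreSparse

/-!
# PercRepro — the instantiation line: C-025 at `(p, 3)` on the CORE OF THE WRAPPER, corank `≥ 6` (p2, gen 11)

`CoreCount.c025_core_of_regime` proves `ThmN.RLS M p 3` for every simple matroid of rank `p ≥ 13` on `p + d` points,
`d ≥ 6`, whose rank-`2` subsets have `≤ 3` points and whose rank-`3` subsets have `≤ 7` points. Night-1's
`RankLevelSetCoreSparse` derives those two sparsity facts from the hypothesis the wrapper `ThmN.rls_succ_all` leaves
on its core — simple, and every element `e` with an `e`-free partition of `E ∖ {e}`. This file is the one-line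
composition: on the wrapper's core, C-025 at `(p, 3)` holds for every `p ≥ 13` and every corank `≥ 6` (and for every
`p ≥ 9`, corank `≥ amin p`).

* **`c025_core_sparse`** — `13 ≤ p`, `p + 6 ≤ |E|`;  **`c025_core_sparse_amin`** — `9 ≤ p`, `p + amin p ≤ |E|`.
Imports `CoreCount` and `RankLevelSetCoreSparse`. Axioms: standard.
-/

namespace PercRepro
namespace CoreCount

variable {α : Type}

/-- **C-025 at `(p, 3)` on the core of the wrapper, corank `≥ 6`, `p ≥ 13`**: simple, every element with an `e`-free
partition, rank `p`, at least `p + 6` points. -/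
theorem c025_core_sparse (M : Matroid α) [M.Finite] (p : ℕ) (hp : 13 ≤ p)
    (hs : ∀ e ∈ M.E, ∀ f ∈ M.E, e ≠ f → M.eRk {e, f} = 2)
    (hfree : ∀ e ∈ M.E, ∃ A ⊆ M.E \ {e}, e ∉ M.closure A ∧ e ∉ M.closure ((M.E \ {e}) \ A))
    (hrank : M.eRank = (p : ℕ∞)) (hd : p + 6 ≤ M.E.ncard) : ThmN.RLS M p 3 :=
  c025_core_of_regime M p (M.E.ncard - p) hp (by omega) hs
    (fun L hL hr => ThmN.ncard_le_three_of_eRk_two M hs hfree hL hr)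
    (fun P hP hr => ThmN.ncard_le_seven_of_eRk_three M hs hfree hP hr) hrank (by omega)

/-- **C-025 at `(p, 3)` on the core of the wrapper for every `p ≥ 9`, corank `≥ amin p`** (`8, 7, 7, 7, 6, 6, …`). -/
theorem c025_core_sparse_amin (M : Matroid α) [M.Finite] (p : ℕ) (hp : 9 ≤ p)
    (hs : ∀ e ∈ M.E, ∀ f ∈ M.E, e ≠ f → M.eRk {e, f} = 2)
    (hfree : ∀ e ∈ M.E, ∃ A ⊆ M.E \ {e}, e ∉ M.closure A ∧ e ∉ M.closure ((M.E \ {e}) \ A))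
    (hrank : M.eRank = (p : ℕ∞)) (hd : p + CoreRegimes.amin p ≤ M.E.ncard) : ThmN.RLS M p 3 :=
  c025_core_of_amin M p (M.E.ncard - p) hp (by omega) hs
    (fun L hL hr => ThmN.ncard_le_three_of_eRk_two M hs hfree hL hr)
    (fun P hP hr => ThmN.ncard_le_seven_of_eRk_three M hs hfree hP hr) hrank (by omega)

end CoreCount
end PercRepro
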